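import Literature.Computability.AlgebraicComplexity.LickteigBorderSubstitution
import Literature.Computability.AlgebraicComplexity.SchoenhageExampleProofs
import HarnessLib

/-!
# Level shadows of the exact thin point carry no rungs: `R̲(⟨u,v,w⟩)` equals a flattening rank
# iff `min(u,v,w) = 1` (route `SaturationLadder`, item stmt-MatrixMultiplication-25909
# `SubexpSaturation`; cell `decomp-mm`, lens 1 «grading / quantitative ladder», gen 32)

PROVED, 0 sorry, no definitions, no named facts, route-free (imports `Literature` only).

*The question priced.*  The crux `SubexpSaturation` asks for EXACT thin points
`ω(1,t,r) = 1 + r` (`t < 1`, `r ≤ exp(c/(1−t))`): the output flattening exponent `1 + r` of the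
format `⟨n, n^t, n^r⟩` is attained asymptotically.  The lens's third naive quantitative axis — after
the RATE axis `c` (gens 5–31: proved for `c > c₂ = (5 log(5/4) + 3 log 2)/3`, open below) and the
FLATNESS axis `η` (gen 25, `…Theorems.SaturationLadderSpectralFloor`: no intermediate rungs) — is the
LEVEL axis `n`: grade the exact point by its finite shadows, the formats `⟨u,v,w⟩ = ⟨⌈n⌉,⌈n^t⌉,⌈n^r⌉⟩`,
and ask at which level the border rank `R̲(⟨u,v,w⟩)` equals the largest flattening rank (finite-level
exactness; by Schönhage's `τ`-theorem a single such level with `u, v, w ≥ 2` would already certify the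
corresponding exact point).  This file closes that axis over every field:

* `flattening_add_le_algBorderRank₁/₂/₃` — the iterated Lickteig increment in each slot:
  `v·w + (u−1) ≤ R̲(⟨u,v,w⟩)`, `u·w + (v−1) ≤ R̲(⟨u,v,w⟩)`, `u·v + (w−1) ≤ R̲(⟨u,v,w⟩)` for
  `u, v, w ≥ 1` (induction on the tree's `algBorderRank_matMulTensor_succ_le` from the conciseness
  bounds `mul_le_algBorderRank_matMulTensor{,_left,_right}`, transported by
  `algBorderRank_matMulTensor_rotate`);
* `flattenings_lt_algBorderRank` — for `u, v, w ≥ 2` EVERY flattening rank is strictly below the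
  border rank (level defect `≥ 1` in every leg; `≥ (third dimension − 1)` by the first group);
* `algBorderRank_eq_flattening_iff` — **`R̲(⟨u,v,w⟩) ∈ {vw, uw, uv}` iff `u = 1 ∨ v = 1 ∨ w = 1`**
  (`u, v, w ≥ 1`): finite-level exactness holds exactly for the matrix–vector formats
  (`algBorderRank_matMulTensor_mid_one` and its rotations `algBorderRank_matMulTensor_one₁/₃`) and
  for no genuinely bilinear format;
* `flattening_add_le_algBorderRank_pow` — the defect persists at every Kronecker level:
  `v^N w^N + (u^N − 1) ≤ R̲(⟨u^N,v^N,w^N⟩)`.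

*Reading for the node.*  Every finite shadow `⟨u,v,w⟩` (`u,v,w ≥ 2`) of every thin exact point is
level-INEXACT, at every Kronecker level; the level ladder under `SubexpSaturation` (and under
`PolySaturation`, `FiniteSaturation`, `E₂`) is EMPTY — exactness of `ω(1,t,r)` is an asymptotic
statement with no finite witness of the form "border rank = flattening rank", and the only surviving
level quantity is the relative defect `log R̲(⟨u^N,v^N,w^N⟩)/log (max flattening) − 1`, whose
vanishing as `N → ∞` IS the crux.  Of the three quantitative axes the lens can put under the root's
deciding crux, two (level `n`, flatness `η`) are now closed by theorems with no intermediate rungs;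
the rate axis `c` remains the only ladder (`…Theorems.SaturationLadderSubexpCriterion`,
`…ClassCeiling`: rungs `c > c₂` proved, `c ≤ c₂` open).  The absolute defect `u − 1` is negligible
against `vw` under powers (`(u^N − 1)/(v^N w^N) → 0` when `u < vw`), so this file is no evidence
about the truth of the crux — it prices the axis, not the point.

*Print scope.*  Lickteig, *A note on border rank*, Inform. Process. Lett. 18 (1984) (the increment, as
reproved in Conner–Harper–Landsberg 2023 §9 and quoted there §1 p. 4 for `⟨2,n,n⟩`, `⟨3,n,n⟩`);
Bürgisser–Clausen–Shokrollahi (1997) (15.12) (`R̲(⟨1,h,1⟩) = h`) and Bläser (2013) Lemma 7.1 /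
Thm. 6.3 (conciseness, symmetry).  The iterated three-slot form and the iff-characterisation of the
formats whose border rank is a flattening rank are assembled here (folklore-level corollaries; not
located verbatim in the held corpus).
References: [Lickteig1984], [ConnerHarperLandsberg2023], [BurgisserClausenShokrollahi1997], [Blaser2013].
-/

set_option linter.dupNamespace false

noncomputable section

namespace Summit.MatrixMultiplication.MatrixMultiplication.Theorems.SaturationLadderLevelShadows

open Literature.Computability.AlgebraicComplexity

universe u

variable (K : Type u) [Field K]

/-! ## §1 The iterated Lickteig increment in each slot -/

/-- `v·w + (u − 1) ≤ R̲(⟨u,v,w⟩)` for `u, v, w ≥ 1`: conciseness `v·w ≤ R̲(⟨1,v,w⟩)` and `u − 1`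
Lickteig increments in the first slot. [cite: Lickteig1984, main result, as reproved in
ConnerHarperLandsberg2023 §9 (p. 18)] -/
theorem flattening_add_le_algBorderRank₁ (u v w : ℕ) (hu : 1 ≤ u) (hv : 1 ≤ v) (hw : 1 ≤ w) :
    v * w + (u - 1) ≤ algBorderRank (matMulTensor K u v w) := by
  induction u, hu using Nat.le_induction with
  | base =>
    haveI : NeZero (1 : ℕ) := ⟨one_ne_zero⟩
    simpa using mul_le_algBorderRank_matMulTensor_right K 1 v w
  | succ u hu ih =>
    have h := algBorderRank_matMulTensor_succ_le K u v w hv hw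
    omega

/-- `u·w + (v − 1) ≤ R̲(⟨u,v,w⟩)` for `u, v, w ≥ 1` (the first-slot bound for `⟨v,w,u⟩`, rotated).
[cite: Lickteig1984, main result; Blaser2013, Thm. 6.3(1)] -/
theorem flattening_add_le_algBorderRank₂ (u v w : ℕ) (hu : 1 ≤ u) (hv : 1 ≤ v) (hw : 1 ≤ w) :
    u * w + (v - 1) ≤ algBorderRank (matMulTensor K u v w) := by
  have h := flattening_add_le_algBorderRank₁ K v w u hv hw hu
  rw [← algBorderRank_matMulTensor_rotate K u v w] at h
  rw [Nat.mul_comm]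
  exact h

/-- `u·v + (w − 1) ≤ R̲(⟨u,v,w⟩)` for `u, v, w ≥ 1` (the first-slot bound for `⟨w,u,v⟩`, rotated twice).
[cite: Lickteig1984, main result; Blaser2013, Thm. 6.3(1)] -/
theorem flattening_add_le_algBorderRank₃ (u v w : ℕ) (hu : 1 ≤ u) (hv : 1 ≤ v) (hw : 1 ≤ w) :
    u * v + (w - 1) ≤ algBorderRank (matMulTensor K u v w) := by
  have h := flattening_add_le_algBorderRank₁ K w u v hw hu hv
  rw [← algBorderRank_matMulTensor_rotate K v w u, ← algBorderRank_matMulTensor_rotate K u v w] at h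
  exact h

/-- For a genuinely bilinear format (`u, v, w ≥ 2`) EVERY flattening rank is strictly below the border
rank: the level defect is positive in every leg. [cite: Lickteig1984, main result, as reproved in
ConnerHarperLandsberg2023 §9 (p. 18)] -/
theorem flattenings_lt_algBorderRank (u v w : ℕ) (hu : 2 ≤ u) (hv : 2 ≤ v) (hw : 2 ≤ w) :
    v * w < algBorderRank (matMulTensor K u v w) ∧ u * w < algBorderRank (matMulTensor K u v w) ∧
      u * v < algBorderRank (matMulTensor K u v w) := by
  have h₁ := flattening_add_le_algBorderRank₁ K u v w (by omega) (by omega) (by omega)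
  have h₂ := flattening_add_le_algBorderRank₂ K u v w (by omega) (by omega) (by omega)
  have h₃ := flattening_add_le_algBorderRank₃ K u v w (by omega) (by omega) (by omega)
  omega

/-! ## §2 The exact levels: matrix–vector formats and nothing else -/

/-- `R̲(⟨1,v,w⟩) = v·w` (rotation of the tree's `R̲(⟨e,1,ℓ⟩) = eℓ`).
[cite: BurgisserClausenShokrollahi1997, (15.12); Blaser2013, Thm. 6.3(1)] -/
theorem algBorderRank_matMulTensor_one₁ (v w : ℕ) : algBorderRank (matMulTensor K 1 v w) = v * w := by
  rw [algBorderRank_matMulTensor_rotate K 1 v w, algBorderRank_matMulTensor_rotate K v w 1,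
    algBorderRank_matMulTensor_mid_one, Nat.mul_comm]

/-- `R̲(⟨u,v,1⟩) = u·v` (rotation of the tree's `R̲(⟨e,1,ℓ⟩) = eℓ`).
[cite: BurgisserClausenShokrollahi1997, (15.12); Blaser2013, Thm. 6.3(1)] -/
theorem algBorderRank_matMulTensor_one₃ (u v : ℕ) : algBorderRank (matMulTensor K u v 1) = u * v := by
  rw [algBorderRank_matMulTensor_rotate K u v 1, algBorderRank_matMulTensor_mid_one, Nat.mul_comm]

/-- **Finite-level exactness iff matrix–vector.**  For `u, v, w ≥ 1`, the border rank of `⟨u,v,w⟩`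
equals one of its three flattening ranks `vw, uw, uv` if and only if `u = 1 ∨ v = 1 ∨ w = 1`.
[cite: Lickteig1984, main result, as reproved in ConnerHarperLandsberg2023 §9 (p. 18);
BurgisserClausenShokrollahi1997, (15.12)] -/
theorem algBorderRank_eq_flattening_iff (u v w : ℕ) (hu : 1 ≤ u) (hv : 1 ≤ v) (hw : 1 ≤ w) :
    (algBorderRank (matMulTensor K u v w) = v * w ∨ algBorderRank (matMulTensor K u v w) = u * w ∨
        algBorderRank (matMulTensor K u v w) = u * v) ↔ (u = 1 ∨ v = 1 ∨ w = 1) := by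
  constructor
  · intro h
    by_contra hne
    push Not at hne
    obtain ⟨hu1, hv1, hw1⟩ := hne
    have hlt := flattenings_lt_algBorderRank K u v w (by omega) (by omega) (by omega)
    omega
  · rintro (rfl | rfl | rfl)
    · exact Or.inl (algBorderRank_matMulTensor_one₁ K v w)
    · exact Or.inr (Or.inl (algBorderRank_matMulTensor_mid_one (K := K) u w))
    · exact Or.inr (Or.inr (algBorderRank_matMulTensor_one₃ K u v))

/-- The complementary reading: for `u, v, w ≥ 2` the border rank is none of the flattening ranks.
[cite: Lickteig1984, main result, as reproved in ConnerHarperLandsberg2023 §9 (p. 18)] -/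
theorem algBorderRank_ne_flattenings (u v w : ℕ) (hu : 2 ≤ u) (hv : 2 ≤ v) (hw : 2 ≤ w) :
    algBorderRank (matMulTensor K u v w) ≠ v * w ∧ algBorderRank (matMulTensor K u v w) ≠ u * w ∧
      algBorderRank (matMulTensor K u v w) ≠ u * v := by
  have h := flattenings_lt_algBorderRank K u v w hu hv hw
  omega

/-! ## §3 The defect at every Kronecker level -/

/-- The level defect persists at every Kronecker level: `v^N w^N + (u^N − 1) ≤ R̲(⟨u^N, v^N, w^N⟩)`
(`u, v, w ≥ 1`; the format of the `N`-th Kronecker power of `⟨u,v,w⟩`).  Relative to the flattening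
`v^N w^N` the defect `u^N − 1` is asymptotically invisible when `u < vw`, consistent with asymptotic
exactness being undecided. [cite: Lickteig1984, main result; Blaser2013, Thm. 6.3(3)] -/
theorem flattening_add_le_algBorderRank_pow (u v w N : ℕ) (hu : 1 ≤ u) (hv : 1 ≤ v) (hw : 1 ≤ w) :
    v ^ N * w ^ N + (u ^ N - 1) ≤ algBorderRank (matMulTensor K (u ^ N) (v ^ N) (w ^ N)) :=
  flattening_add_le_algBorderRank₁ K (u ^ N) (v ^ N) (w ^ N) (Nat.one_le_pow _ _ hu)
    (Nat.one_le_pow _ _ hv) (Nat.one_le_pow _ _ hw)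

/-- At every Kronecker level of a genuinely bilinear format the shadow stays level-inexact in all three
legs (`u, v, w ≥ 2`, `N ≥ 1`). [cite: Lickteig1984, main result; Blaser2013, Thm. 6.3(3)] -/
theorem flattenings_lt_algBorderRank_pow (u v w N : ℕ) (hu : 2 ≤ u) (hv : 2 ≤ v) (hw : 2 ≤ w)
    (hN : 1 ≤ N) :
    v ^ N * w ^ N < algBorderRank (matMulTensor K (u ^ N) (v ^ N) (w ^ N)) ∧
      u ^ N * w ^ N < algBorderRank (matMulTensor K (u ^ N) (v ^ N) (w ^ N)) ∧
        u ^ N * v ^ N < algBorderRank (matMulTensor K (u ^ N) (v ^ N) (w ^ N)) := by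
  have h2 : ∀ x : ℕ, 2 ≤ x → 2 ≤ x ^ N := fun x hx =>
    le_trans (by simpa using Nat.pow_le_pow_left hx 1) (Nat.pow_le_pow_right (by omega) hN)
  exact flattenings_lt_algBorderRank K (u ^ N) (v ^ N) (w ^ N) (h2 u hu) (h2 v hv) (h2 w hw)

end Summit.MatrixMultiplication.MatrixMultiplication.Theorems.SaturationLadderLevelShadows

end
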